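import Literature.NumberTheory.BeurlingPrimes.WellBehavedSystemsQuantile
import HarnessLib

/-!
# Broucke–Vindas 2024, Theorem 1.2 — II. The coupled prime system `p_j = G(j + ω_j)`

Topic `Literature/NumberTheory/BeurlingPrimes`, grouping namespace `BrouckeVindas` (Broucke–Vindas 2024, §2,
proof of Theorem 1.2). Everything in this file is PROVED and definition-free: the data are an admissible `F`, a
generalized inverse `G` of `F` (Galois property `G(s) ≤ y ↔ s ≤ F(y)`, part I), a sequence `ω ∈ (0,1]^ℕ`, a
Beurling system `P` with `P.prime j = G(j + ω_j)` (it exists: `exists_beurlingPrimes`), and the deviation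
`D(ω, n, t) = Σ_{j<n} G(j+ω_j)^{−it} − ∫_{(0,n]} G(s)^{−it} ds` given through its defining equation `hD`.

Deterministic content of BV §2 in this coupling (BV: `P_j(ω) ∈ (q_{j−1}, q_j]`, "`|π_𝒫(x) − F_c(x)| ≤ 1` by
construction", "`S(x,k) = S(q_{j−1},k) + O(1)`", "for negative `t` … complex conjugate"):
* `prime_le_iff_of_coupling`: `p_j ≤ y ↔ j + ω_j ≤ F(y)`; hence `⌊F y⌋ ≤ π(y) ≤ ⌊F y⌋ + 1` and
  **`|π_𝒫(y) − F(y)| ≤ 1`** for every admissible `F` (`abs_primeCount_sub_le_one`); `StrictMono` for continuous `F`.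
* `norm_primeSum_sub_sub_dev_le`: `‖S_𝒫(y,t) − ∫_{[1,y]} u^{−it}dF(u) − D(ω,⌊F y⌋,t)‖ ≤ 2` (mass-level reduction).
* `norm_dev_sub_dev_le`: `‖D(ω,n,t) − D(ω,n,t')‖ ≤ 2n|t − t'| log G(n)` (replaces partial summation in `t`).
* `norm_primeSum_sub_stieltjesExpSum_neg`: the error is even in `t`.

## References
* [BrouckeVindas2024] F. Broucke, J. Vindas, *A new generalized prime random approximation procedure and some of
  its applications*, Math. Z. 307 (2024), arXiv:2102.08478, §2 (proof of Theorem 1.2) (read).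
-/

noncomputable section

open Complex Filter MeasureTheory Set
open scoped Topology ComplexConjugate

namespace Literature.NumberTheory.BeurlingPrimes

open Literature.Barriers.RiemannHypothesis

namespace BrouckeVindas

variable {F : StieltjesFunction ℝ} {G : ℝ → ℝ} {ω : ℕ → ℝ}
variable (h1 : F 1 = 0) (hG : ∀ ⦃s : ℝ⦄, 0 < s → ∀ y : ℝ, G s ≤ y ↔ s ≤ F y) (hGm : Monotone G)
variable (hω : ∀ j, ω j ∈ Ioc (0 : ℝ) 1)

/-! ### The coupled Beurling system -/

include hω in
/-- `0 < j + ω_j`. [cite: BrouckeVindas2024, §2] -/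
theorem natCast_add_pos (j : ℕ) : 0 < (j : ℝ) + ω j := by
  have := (hω j).1
  positivity

include hω in
/-- `j + ω_j ≤ j + 1`. [cite: BrouckeVindas2024, §2] -/
theorem natCast_add_le_succ (j : ℕ) : (j : ℝ) + ω j ≤ (j + 1 : ℕ) := by
  have := (hω j).2
  push_cast
  linarith

include h1 hG hGm hω in
/-- **The coupled prime system exists**: `p_j = G(j + ω_j)` is a Beurling system (`p_0 > 1`, non-decreasing,
`→ ∞`) (BV: `p_j = P_j(ω)`, `P_j` distributed on `(q_{j−1}, q_j]` according to `dF`).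
[cite: BrouckeVindas2024, §2 (proof of Theorem 1.2)] -/
theorem exists_beurlingPrimes : ∃ P : BeurlingPrimes, ∀ j, P.prime j = G (j + ω j) :=
  ⟨{ prime := fun j ↦ G (j + ω j),
     one_lt := one_lt_of_galois h1 hG (natCast_add_pos hω 0),
     mono := monotone_nat_of_le_succ fun j ↦ hGm
       ((natCast_add_le_succ hω j).trans (le_add_of_nonneg_right (hω (j + 1)).1.le)),
     tendsto_atTop := tendsto_atTop_mono (fun j ↦ hGm (le_add_of_nonneg_right (hω j).1.le))
       (tendsto_natCast_of_galois hG) }, fun _ ↦ rfl⟩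

variable {P : BeurlingPrimes} (hP : ∀ j, P.prime j = G (j + ω j))

include hG hω hP in
/-- `p_j ≤ y ↔ j + ω_j ≤ F(y)`. [cite: BrouckeVindas2024, §2] -/
theorem prime_le_iff_of_coupling {j : ℕ} {y : ℝ} : P.prime j ≤ y ↔ (j : ℝ) + ω j ≤ F y := by
  rw [hP]
  exact hG (natCast_add_pos hω j) y

include hG hGm hω hP in
/-- The primes are strictly increasing when `F` is continuous. [cite: BrouckeVindas2024, Theorem 1.2] -/
theorem strictMono_prime (hc : Continuous fun x : ℝ ↦ F x) : StrictMono P.prime := by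
  refine strictMono_nat_of_lt_succ fun j ↦ ?_
  rw [hP, hP]
  exact lt_of_galois_of_continuous hG hGm hc (natCast_add_pos hω j)
    ((natCast_add_le_succ hω j).trans_lt (lt_add_of_pos_right _ (hω (j + 1)).1))

include hG hω hP in
/-- `⌊F(y)⌋ ≤ π(y)` (as `indexOf`). [cite: BrouckeVindas2024, §2 ("|π_𝒫(x) − F_c(x)| ≤ 1")] -/
theorem floor_le_indexOf (h0 : ∀ x, 0 ≤ F x) (y : ℝ) : ⌊F y⌋₊ ≤ P.indexOf y := by
  rcases Nat.eq_zero_or_pos ⌊F y⌋₊ with h | h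
  · rw [h]; exact Nat.zero_le _
  · have hj : ((⌊F y⌋₊ - 1 : ℕ) : ℝ) + ω (⌊F y⌋₊ - 1) ≤ F y := by
      have h2 : ((⌊F y⌋₊ - 1 : ℕ) : ℝ) + 1 = ⌊F y⌋₊ := by
        rw [Nat.cast_sub h]; push_cast; ring
      linarith [(hω (⌊F y⌋₊ - 1)).2, Nat.floor_le (h0 y)]
    have := (P.prime_le_iff).1 ((prime_le_iff_of_coupling hG hω hP).2 hj)
    omega

include hG hω hP in
/-- `π(y) ≤ ⌊F(y)⌋ + 1` (as `indexOf`). [cite: BrouckeVindas2024, §2 ("|π_𝒫(x) − F_c(x)| ≤ 1")] -/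
theorem indexOf_le_floor_add_one (y : ℝ) : P.indexOf y ≤ ⌊F y⌋₊ + 1 := by
  by_contra h
  have hlt : ⌊F y⌋₊ + 1 < P.indexOf y := not_le.1 h
  have hle : ((⌊F y⌋₊ + 1 : ℕ) : ℝ) + ω (⌊F y⌋₊ + 1) ≤ F y :=
    (prime_le_iff_of_coupling hG hω hP).1 ((P.prime_le_iff).2 hlt)
  have h3 := Nat.lt_floor_add_one (F y)
  have h4 := (hω (⌊F y⌋₊ + 1)).1
  push_cast at hle
  linarith

include hG hω hP in
/-- **`|π_𝒫(y) − F(y)| ≤ 1`** for the coupled system (BV obtain `≤ 1` for the continuous part and `≤ 2` in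
general; the quantile coupling gives `≤ 1` for every admissible `F`). [cite: BrouckeVindas2024, Theorem 1.2] -/
theorem abs_primeCount_sub_le_one (h0 : ∀ x, 0 ≤ F x) (y : ℝ) : |(P.primeCount y : ℝ) - F y| ≤ 1 := by
  rw [P.primeCount_eq_indexOf]
  have hlo := floor_le_indexOf hG hω hP h0 y
  have hhi := indexOf_le_floor_add_one hG hω hP y
  have h3 := Nat.lt_floor_add_one (F y)
  have h4 := Nat.floor_le (h0 y)
  have hlo' : (⌊F y⌋₊ : ℝ) ≤ P.indexOf y := by exact_mod_cast hlo
  have hhi' : (P.indexOf y : ℝ) ≤ ⌊F y⌋₊ + 1 := by exact_mod_cast hhi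
  rw [abs_le]
  constructor <;> linarith

/-! ### The deviation `D(ω, n, t)` and the exponential sums -/

variable {D : (ℕ → ℝ) → ℕ → ℝ → ℂ}
variable (hD : ∀ (ω : ℕ → ℝ) (n : ℕ) (t : ℝ), D ω n t =
  ∑ j ∈ Finset.range n, ((G (j + ω j) : ℂ)) ^ (-(t * I)) - ∫ s in Ioc (0 : ℝ) n, ((G s : ℂ)) ^ (-(t * I)))

include hD in
/-- `D(ω, 0, t) = 0`. [cite: BrouckeVindas2024, §2] -/
theorem dev_zero (ω : ℕ → ℝ) (t : ℝ) : D ω 0 t = 0 := by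
  rw [hD]
  simp

include hG hGm hω hP hD in
/-- **Mass-level reduction**: `‖S_𝒫(y,t) − ∫_{[1,y]} u^{−it} dF(u) − D(ω,⌊F y⌋,t)‖ ≤ 2` (at most one prime and
mass `< 1` of `dF` lie between mass level `⌊F(y)⌋` and `y`; BV: "`S(x,k) = S(q_{j−1},k) + O(1)`").
[cite: BrouckeVindas2024, §2 (proof of Theorem 1.2)] -/
theorem norm_primeSum_sub_sub_dev_le (hG1 : ∀ s, 1 ≤ G s) (h0 : ∀ x, 0 ≤ F x) (y t : ℝ) :
    ‖P.primeSum y t - stieltjesExpSum F y t - D ω ⌊F y⌋₊ t‖ ≤ 2 := by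
  set n := ⌊F y⌋₊ with hn
  have hnle : (n : ℝ) ≤ F y := Nat.floor_le (h0 y)
  have hlt1 : F y < n + 1 := Nat.lt_floor_add_one (F y)
  -- the tail integral
  have htail : ‖∫ s in Ioc (n : ℝ) (F y), ((G s : ℂ)) ^ (-(t * I))‖ ≤ 1 := by
    refine (norm_integral_cpow_comp_le hG1 t (by simp)).trans ?_
    rw [Real.volume_real_Ioc_of_le hnle]
    linarith
  -- the prime sum is `Σ_{j<n}` plus at most one term
  have hsum : ‖P.primeSum y t - ∑ j ∈ Finset.range n, ((G (j + ω j) : ℂ)) ^ (-(t * I))‖ ≤ 1 := by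
    have hlo : n ≤ P.indexOf y := floor_le_indexOf hG hω hP h0 y
    have hhi : P.indexOf y ≤ n + 1 := indexOf_le_floor_add_one hG hω hP y
    unfold BeurlingPrimes.primeSum
    simp only [hP]
    rcases Nat.eq_or_lt_of_le hlo with heq | hlt
    · rw [← heq]
      simp
    · have heq : P.indexOf y = n + 1 := le_antisymm hhi hlt
      rw [heq, Finset.sum_range_succ, add_sub_cancel_left]
      exact (norm_cpow_comp hG1 _ t).le
  rw [stieltjesExpSum_eq_integral hG hGm hG1 h0 y t, integral_Ioc_eq_add hGm hG1 hnle t, hD]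
  calc ‖P.primeSum y t - ((∫ s in Ioc (0 : ℝ) n, ((G s : ℂ)) ^ (-(t * I))) +
          ∫ s in Ioc (n : ℝ) (F y), ((G s : ℂ)) ^ (-(t * I))) -
          (∑ j ∈ Finset.range n, ((G (j + ω j) : ℂ)) ^ (-(t * I)) -
            ∫ s in Ioc (0 : ℝ) n, ((G s : ℂ)) ^ (-(t * I)))‖
      = ‖(P.primeSum y t - ∑ j ∈ Finset.range n, ((G (j + ω j) : ℂ)) ^ (-(t * I))) -
          ∫ s in Ioc (n : ℝ) (F y), ((G s : ℂ)) ^ (-(t * I))‖ := by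
        congr 1; ring
    _ ≤ ‖P.primeSum y t - ∑ j ∈ Finset.range n, ((G (j + ω j) : ℂ)) ^ (-(t * I))‖ +
          ‖∫ s in Ioc (n : ℝ) (F y), ((G s : ℂ)) ^ (-(t * I))‖ := norm_sub_le _ _
    _ ≤ 1 + 1 := add_le_add hsum htail
    _ = 2 := by norm_num

include hGm hω hD in
/-- **Perturbation in `t`** (replaces BV's partial summation): `‖D(ω,n,t) − D(ω,n,t')‖ ≤ 2n|t − t'| log G(n)`,
since all primes and quantiles involved lie in `[1, G(n)]`. [cite: BrouckeVindas2024, §2 (proof of Theorem 1.2)] -/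
theorem norm_dev_sub_dev_le (hG1 : ∀ s, 1 ≤ G s) (n : ℕ) (t t' : ℝ) :
    ‖D ω n t - D ω n t'‖ ≤ 2 * n * (|t - t'| * Real.log (G n)) := by
  set L := |t - t'| * Real.log (G n) with hL
  have hGn : ∀ s : ℝ, s ≤ n → Real.log (G s) ≤ Real.log (G n) := fun s hs ↦
    Real.log_le_log (one_pos.trans_le (hG1 s)) (hGm hs)
  have hbound : ∀ s : ℝ, s ≤ n → ‖((G s : ℂ)) ^ (-(t * I)) - ((G s : ℂ)) ^ (-(t' * I))‖ ≤ L := fun s hs ↦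
    (norm_cpow_negI_sub_le (hG1 s) t t').trans (mul_le_mul_of_nonneg_left (hGn s hs) (abs_nonneg _))
  -- the sum over primes
  have hS : ‖∑ j ∈ Finset.range n, (((G (j + ω j) : ℂ)) ^ (-(t * I)) - ((G (j + ω j) : ℂ)) ^ (-(t' * I)))‖
      ≤ n * L := by
    refine (norm_sum_le _ _).trans ?_
    have : ∀ j ∈ Finset.range n,
        ‖((G (j + ω j) : ℂ)) ^ (-(t * I)) - ((G (j + ω j) : ℂ)) ^ (-(t' * I))‖ ≤ L :=
      fun j hj ↦ hbound _ ((natCast_add_le_succ hω j).trans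
        (by exact_mod_cast Nat.succ_le_of_lt (Finset.mem_range.1 hj)))
    refine (Finset.sum_le_sum this).trans ?_
    simp
  -- the integral
  have hI : ‖∫ s in Ioc (0 : ℝ) n, (((G s : ℂ)) ^ (-(t * I)) - ((G s : ℂ)) ^ (-(t' * I)))‖ ≤ L * n := by
    have h := norm_setIntegral_le_of_norm_le_const (show volume (Ioc (0 : ℝ) n) < ⊤ by simp)
      (f := fun s : ℝ ↦ ((G s : ℂ)) ^ (-(t * I)) - ((G s : ℂ)) ^ (-(t' * I))) (C := L) fun s hs ↦ hbound s hs.2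
    rwa [Real.volume_real_Ioc_of_le (Nat.cast_nonneg n), sub_zero] at h
  have hrw : D ω n t - D ω n t' =
      ∑ j ∈ Finset.range n, (((G (j + ω j) : ℂ)) ^ (-(t * I)) - ((G (j + ω j) : ℂ)) ^ (-(t' * I))) -
        ∫ s in Ioc (0 : ℝ) n, (((G s : ℂ)) ^ (-(t * I)) - ((G s : ℂ)) ^ (-(t' * I))) := by
    rw [hD, hD, Finset.sum_sub_distrib, integral_sub (integrableOn_cpow_comp hGm hG1 t (by simp))
      (integrableOn_cpow_comp hGm hG1 t' (by simp))]
    ring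
  rw [hrw]
  calc _ ≤ n * L + L * n := (norm_sub_le _ _).trans (add_le_add hS hI)
    _ = 2 * n * L := by ring

/-! ### Negative `t` by conjugation -/

/-- `S_𝒬(y, −t) = conj S_𝒬(y, t)` for every Beurling system. [cite: BrouckeVindas2024, §2 ("for negative t we
obtain the same bounds by taking the complex conjugate")] -/
theorem primeSum_neg (Q : BeurlingPrimes) (y t : ℝ) : Q.primeSum y (-t) = conj (Q.primeSum y t) := by
  unfold BeurlingPrimes.primeSum
  rw [map_sum]
  refine Finset.sum_congr rfl fun j _ ↦ ?_
  exact cpow_negI_neg (Q.prime_pos j) t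

include hG hGm in
/-- `∫_{[1,y]} u^{it} dF(u) = conj ∫_{[1,y]} u^{−it} dF(u)`. [cite: BrouckeVindas2024, §2] -/
theorem stieltjesExpSum_neg (hG1 : ∀ s, 1 ≤ G s) (h0 : ∀ x, 0 ≤ F x) (y t : ℝ) :
    stieltjesExpSum F y (-t) = conj (stieltjesExpSum F y t) := by
  rw [stieltjesExpSum_eq_integral hG hGm hG1 h0, stieltjesExpSum_eq_integral hG hGm hG1 h0, ← integral_conj]
  refine setIntegral_congr_fun measurableSet_Ioc fun s _ ↦ ?_
  exact cpow_negI_neg (one_pos.trans_le (hG1 s)) t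

include hG hGm in
/-- The approximation error is even in `t`: `‖S(y,−t) − ∫ u^{it} dF‖ = ‖S(y,t) − ∫ u^{−it} dF‖`.
[cite: BrouckeVindas2024, §2] -/
theorem norm_primeSum_sub_stieltjesExpSum_neg (hG1 : ∀ s, 1 ≤ G s) (h0 : ∀ x, 0 ≤ F x) (Q : BeurlingPrimes)
    (y t : ℝ) :
    ‖Q.primeSum y (-t) - stieltjesExpSum F y (-t)‖ = ‖Q.primeSum y t - stieltjesExpSum F y t‖ := by
  rw [primeSum_neg, stieltjesExpSum_neg hG hGm hG1 h0, ← map_sub, Complex.norm_conj]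

end BrouckeVindas

end Literature.NumberTheory.BeurlingPrimes
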